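import Summits.NavierStokesRegularity.NavierStokesRegularity.Theorems.TypeIQuarterGateScarEnvelopeTypeISatelliteTowerRootRateDefs
import Summits.NavierStokesRegularity.NavierStokesRegularity.Theorems.TypeIQuarterGateScarEnvelopeTypeISatelliteTowerGallerySeqCompact
import Summits.NavierStokesRegularity.NavierStokesRegularity.Theorems.TypeIQuarterGateScarEnvelopeTypeISatelliteTowerClosure
import Summits.NavierStokesRegularity.NavierStokesRegularity.Theorems.TypeIQuarterGateScarEnvelopeTypeISatelliteTowerEnvelopeStability
import Summits.NavierStokesRegularity.NavierStokesRegularity.Theorems.TypeIQuarterGateScarEnvelopeTypeISatelliteTowerHullCells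
import Summits.NavierStokesRegularity.NavierStokesRegularity.Theorems.SqueezeCycleRecurrentLiouvilleSmallHullRemoval
import Summits.NavierStokesRegularity.NavierStokesRegularity.Theorems.RecurrentProfilesRecurrentLiouvilleFrFastRecurrenceRemoval
import Summits.NavierStokesRegularity.NavierStokesRegularity.Theorems.RecurrentProfilesRecurrentLiouvilleFrEpochRemoval
import Literature.Analysis.FluidPDE.ScalingRecurrentSlabField
import Summits.NavierStokesRegularity.NavierStokesRegularity.Theorems.ClockStretchingLawSteadySliceLiouvilleAnalytic
import Summits.NavierStokesRegularity.NavierStokesRegularity.Theorems.OddMorawetzMorawetzKillsTypeISelfSimilarRigidity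
import Summits.NavierStokesRegularity.NavierStokesRegularity.Theorems.ScenarioCensusFixedAxis
import Literature.Analysis.FluidPDE.BarkerPrange2020VorticityAlignmentTypeIHolds
import Literature.Analysis.FluidPDE.TypeIAncientMildRescale
import HarnessLib
import Literature.Analysis.FunctionSpaces.TestFunctionDensity
import Summits.NavierStokesRegularity.NavierStokesRegularity.Theorems.TypeIQuarterGateScarEnvelopeTypeISatelliteTowerDefectFloor

/-!
# Satellite tower for crux `ScarEnvelopeTypeI` (stmt-NavierStokesRegularity-23843) — ROUND-47 Part K, K1–K2: KEYHOLE TRANSFER OF SMALLNESS (class-uniform qualitative three-cylinder principle for A–B objects: δ-close in L³ on ANY open keyhole of the past ⇒ ε-close in L³(Q₁); the near-identity DSS rung is open at each fixed factor THROUGH ANY KEYHOLE)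

Module (27a) of the landing form (plate l.979–987, 995–1165): K1 ★★★ `abTower_smallness_transfer` (∀ open nonempty keyhole `O ⊆ Q_{R₀}(0,0)`, ∀ ε > 0
∃ δ(M, I, O, ε) > 0: two A–B objects at level ≤ I that are δ-close in `L³(O)` are ε-close in `L³(Q₁)` — identity theorem E2′ `eq_past_of_ae_eq_on` +
`abTower_seqCompact`); K1′ `abTower_orbit_smallness_transfer` (δ independent of the scale `c`, via `abTower_zoom`); K2 ★★★
`abTower_nearOne_defect_floor_keyhole` (ROUND-46 E16 through any keyhole); K2′ `RootObj.nearOne_defect_floor_keyhole`.  Requires the tree's ROUND-46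
modules (26a) `…SatelliteTowerUniqueContinuation` and (26c) `…SatelliteTowerDefectFloor`.  DEDUP REWRITE (the only deviation from VERBATIM, gate
`dedup.landed` on p675419): the plate's helper `ennreal_inv_natCast_add_one_tendsto_zero` (l.988–993) restates the Literature lemma
`Literature.Analysis.FunctionSpaces.tendsto_inv_natCast_add_one` (`Literature/Analysis/FunctionSpaces/TestFunctionDensity.lean`) and is NOT landed; its one
use in K1's proof (plate l.1053) is rewritten to the Literature name.

PROVENANCE: declaration texts VERBATIM from the HOME artefact of the instrument seat nsreg-p3 g29 (cell `pub/ns-regularity-ideate`):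
`round-47/partK47.lean` (sha16 `868e779d1667521b`; = the ROUND-46 v1.1 plate text byte-identically + `section Keyhole`, plate l.977–1256, 9 declarations;
written against the TREE over the landed census modules and the crux-1589 lineage modules `Theorems.SqueezeCycleRecurrentLiouvilleSmallHullRemoval`,
`…RecurrentProfilesRecurrentLiouvilleFrFastRecurrenceRemoval`, `…FrEpochRemoval`; memo `round-47/ROUND-47.md` 8baeb760d925f076), scored by referee ref3
(`SCORE-p3-ROUND-47-0828.md`); the author cannot write under `Theorems/` (`perm.theorems-prover-only`); landed by the prover ns-es-p1 g6 as landing hand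
of record (director-ns DIRECTOR-NS #237 (3)) following the landing form ROUND-47.md §7 (27a)(27b); the ROUND-46 part of the plate is NOT re-landed (it is
the tree's `…SatelliteTowerUniqueContinuation/…NoExactReturn/…DefectFloor`, p673498/p673555/p673853); the artefact's `#guard_msgs … #print axioms`
certificates are not landed.  `--supports stmt-NavierStokesRegularity-23843 --as helper`.

HONEST FRAMING: qualitative «three-cylinder» / keyhole INSTRUMENT theorems about HYPOTHETICAL Type-I zoom limits (Albritton–Barker objects of the census of
crux `TypeIQuarterGate.ScarEnvelopeTypeI`, item 23843; classes possibly empty).  WHERE NS ENTERS = the identity theorem E2′ (space–time analyticity,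
LR 2016 Thm 9.12, BY NAME) + CKN/A–B compactness (`abTower_seqCompact`); mechanism = Tikhonov «injective + compact ⇒ uniformly continuous inverse», KNOWN;
ALL moduli δ/η/θ are INEFFECTIVE (contradiction + compactness).  Movement 0 on anything open: item 23843, route TypeIQuarterGate, crux 1589
`RecurrentLiouville`, (ρ)/(θ′)/(υ), the DSS cells (τ)(κ) at coarse ratio, N0 and Navier–Stokes regularity are all OPEN — NS regularity is NOT proved
here; no decl is an edge or a proof-of-item (plate audit: orphan 51 / closes 0).  Nearest print (memo §6): Lin–Wang quantitative three-cylinder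
uniqueness for the non-stationary Stokes system (the EFFECTIVE spatial leg, not used here); in-tree neighbour: the typed Prop `AnalyticPropagationOfSmallness`.
-/

noncomputable section

-- the summit-side namespace repeats a component by design (single-conjunct summit, D-0017)
set_option linter.dupNamespace false

open MeasureTheory Set Metric Filter Topology Function
open scoped ENNReal NNReal
open Literature.Analysis.FluidPDE

namespace Summit.NavierStokesRegularity.NavierStokesRegularity.Cruxes.ScarEnvelopeTypeI.ZoomDictionary

section Keyhole

/-! ## Part K (ROUND-47 core) — KEYHOLE TRANSFER OF SMALLNESS

WHERE NS ENTERS: the identity theorem for the Type-I ancient mild class (E2′, space–time analyticity, LR 2016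
Thm 9.12) + CKN/A–B compactness (`abTower_seqCompact`).  Output: a CLASS-UNIFORM, scale-free, qualitative
«three-cylinder inequality»: two A–B objects of the class that are `δ`-close in `L³` on ANY open keyhole
`O ⋐ Q_{R₀}(0,0)` of the open past are `ε`-close in `L³(Q₁(0,0))`, `δ = δ(M, I, O, ε)` — and through it KEYHOLE
forms of the crux-1589 lineage's removals (near-identity rung Z3/H4, `smallHullRemoval`,
`stub_frFastRecurrenceRemoval`, `stub_frEpochRemoval`), whose hypotheses are all measured on `Q₁(0,0)`. -/

/-- ★★★ **K1. CLASS-UNIFORM TRANSFER OF SMALLNESS FROM ANY KEYHOLE TO THE UNIT CYLINDER** (qualitative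
three-cylinder inequality for the A–B class).  Fix the rate `M`, a level `I < ⊤`, an open nonempty keyhole
`O ⊆ Q_{R₀}(0,0)` and `ε > 0`.  There is `δ = δ(M, I, O, ε) > 0` such that ANY two A–B objects of the class with
`𝐈 ≤ I` which are `δ`-close in `L³(O)` are `ε`-close in `L³(Q₁(0,0))`.  (False for merely smooth compact
families; the rigidity is analytic continuation: two `L³_loc` subsequential limits agree a.e. on `O`, hence on
the whole open past by E2′, so the distance on `Q₁` of the approximants tends to `0`.)  `δ` is ineffective. -/
theorem abTower_smallness_transfer (M : ℝ) {I : ℝ≥0∞} (hI : I < ⊤)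
    {O : Set (ℝ × (EuclideanSpace ℝ (Fin 3)))} (hO : IsOpen O) (hne : O.Nonempty) {R₀ : ℝ} (hR₀ : 0 < R₀)
    (hOs : O ⊆ parabolicCylinder R₀ (0 : ℝ × (EuclideanSpace ℝ (Fin 3)))) {ε : ℝ≥0∞} (hε : 0 < ε) :
    ∃ δ : ℝ≥0∞, 0 < δ ∧
      ∀ (U : ℝ → (EuclideanSpace ℝ (Fin 3)) → (EuclideanSpace ℝ (Fin 3)))
        (P : ℝ → (EuclideanSpace ℝ (Fin 3)) → ℝ)
        (H : ℝ → (EuclideanSpace ℝ (Fin 3)) → (EuclideanSpace ℝ (Fin 3)) →L[ℝ] (EuclideanSpace ℝ (Fin 3)))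
        (W : ℝ → (EuclideanSpace ℝ (Fin 3)) → (EuclideanSpace ℝ (Fin 3)))
        (P' : ℝ → (EuclideanSpace ℝ (Fin 3)) → ℝ)
        (H' : ℝ → (EuclideanSpace ℝ (Fin 3)) → (EuclideanSpace ℝ (Fin 3)) →L[ℝ] (EuclideanSpace ℝ (Fin 3))),
        ABTower M U P H → ABTower M W P' H' →
          typeIBound (Iio (0 : ℝ) ×ˢ (univ : Set (EuclideanSpace ℝ (Fin 3)))) U P H ≤ I →
          typeIBound (Iio (0 : ℝ) ×ˢ (univ : Set (EuclideanSpace ℝ (Fin 3)))) W P' H' ≤ I →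
          eLpNorm (uncurry U - uncurry W) 3 (volume.restrict O) ≤ δ →
          eLpNorm (uncurry U - uncurry W) 3
            (volume.restrict (parabolicCylinder 1 (0 : ℝ × (EuclideanSpace ℝ (Fin 3))))) < ε := by
  by_contra hcon
  push Not at hcon
  have hpos : ∀ k : ℕ, (0 : ℝ≥0∞) < ((k : ℝ≥0∞) + 1)⁻¹ :=
    fun k => ENNReal.inv_pos.2 (ENNReal.add_ne_top.2 ⟨ENNReal.natCast_ne_top k, ENNReal.one_ne_top⟩)
  choose Us Ps Hs Ws Ps' Hs' hAB hAB' hIk hIk' hsmall hbig using fun k : ℕ => hcon _ (hpos k)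
  -- two nested compactness extractions
  obtain ⟨U', PU, HU, σ, hσ, hABU, -, -, hconvU, -⟩ := abTower_seqCompact hI Us Ps Hs hAB hIk
  obtain ⟨W', PW, HW, τ, hτ, hABW, -, -, hconvW, -⟩ :=
    abTower_seqCompact hI (fun j => Ws (σ j)) (fun j => Ps' (σ j)) (fun j => Hs' (σ j))
      (fun j => hAB' (σ j)) (fun j => hIk' (σ j))
  set φ : ℕ → ℕ := fun j => σ (τ j) with hφ
  have hφm : StrictMono φ := hσ.comp hτ
  have hconvU' : ∀ R : ℝ, 0 < R → Tendsto (fun j => eLpNorm (uncurry (Us (φ j)) - uncurry U') 3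
      (volume.restrict (parabolicCylinder R (0 : ℝ × (EuclideanSpace ℝ (Fin 3)))))) atTop (𝓝 0) :=
    fun R hR => (hconvU R hR).comp hτ.tendsto_atTop
  have hconvW' : ∀ R : ℝ, 0 < R → Tendsto (fun j => eLpNorm (uncurry (Ws (φ j)) - uncurry W') 3
      (volume.restrict (parabolicCylinder R (0 : ℝ × (EuclideanSpace ℝ (Fin 3)))))) atTop (𝓝 0) :=
    fun R hR => hconvW R hR
  -- measurability on the keyhole and on cylinders
  have hslab : ∀ {V : ℝ → (EuclideanSpace ℝ (Fin 3)) → (EuclideanSpace ℝ (Fin 3))} {PV : ℝ → (EuclideanSpace ℝ (Fin 3)) → ℝ}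
      {HV : ℝ → (EuclideanSpace ℝ (Fin 3)) → (EuclideanSpace ℝ (Fin 3)) →L[ℝ] (EuclideanSpace ℝ (Fin 3))},
      ABTower M V PV HV → ContinuousOn (uncurry V) (Iio (0 : ℝ) ×ˢ (univ : Set (EuclideanSpace ℝ (Fin 3)))) :=
    fun h => h.1.continuousOn_uncurry
  have hμO : volume.restrict O ≤ volume.restrict (parabolicCylinder R₀ (0 : ℝ × (EuclideanSpace ℝ (Fin 3)))) :=
    Measure.restrict_mono hOs le_rfl
  have hmO : ∀ {V : ℝ → (EuclideanSpace ℝ (Fin 3)) → (EuclideanSpace ℝ (Fin 3))},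
      ContinuousOn (uncurry V) (Iio (0 : ℝ) ×ˢ (univ : Set (EuclideanSpace ℝ (Fin 3)))) →
      AEStronglyMeasurable (uncurry V) (volume.restrict O) :=
    fun hV => (aestronglyMeasurable_parabolicCylinder_of_continuousOn hV R₀).mono_measure hμO
  -- on the keyhole: `U_φj → U'` and `U_φj → W'`
  have h1 : Tendsto (fun j => eLpNorm (uncurry (Us (φ j)) - uncurry U') 3 (volume.restrict O)) atTop (𝓝 0) :=
    tendsto_of_tendsto_of_tendsto_of_le_of_le tendsto_const_nhds (hconvU' R₀ hR₀) (fun _ => bot_le)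
      fun j => eLpNorm_mono_measure _ hμO
  have hOsmall : Tendsto (fun j => eLpNorm (uncurry (Us (φ j)) - uncurry (Ws (φ j))) 3 (volume.restrict O))
      atTop (𝓝 0) :=
    tendsto_of_tendsto_of_tendsto_of_le_of_le tendsto_const_nhds
      (Literature.Analysis.FunctionSpaces.tendsto_inv_natCast_add_one.comp hφm.tendsto_atTop) (fun _ => bot_le) fun j => hsmall (φ j)
  have hWO : Tendsto (fun j => eLpNorm (uncurry (Ws (φ j)) - uncurry W') 3 (volume.restrict O)) atTop (𝓝 0) :=
    tendsto_of_tendsto_of_tendsto_of_le_of_le tendsto_const_nhds (hconvW' R₀ hR₀) (fun _ => bot_le)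
      fun j => eLpNorm_mono_measure _ hμO
  have h2 : Tendsto (fun j => eLpNorm (uncurry (Us (φ j)) - uncurry W') 3 (volume.restrict O)) atTop (𝓝 0) := by
    have hsum := hOsmall.add hWO
    rw [add_zero] at hsum
    refine tendsto_of_tendsto_of_tendsto_of_le_of_le tendsto_const_nhds hsum (fun _ => bot_le) fun j => ?_
    have e : uncurry (Us (φ j)) - uncurry W' =
        (uncurry (Us (φ j)) - uncurry (Ws (φ j))) + (uncurry (Ws (φ j)) - uncurry W') := by abel
    rw [e]
    exact eLpNorm_add_le ((hmO (hslab (hAB _))).sub (hmO (hslab (hAB' _))))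
      ((hmO (hslab (hAB' _))).sub (hmO (hslab hABW))) (by norm_num)
  have hae : uncurry U' =ᵐ[volume.restrict O] uncurry W' :=
    ae_eq_of_tendsto_eLpNorm_three (f := fun j => uncurry (Us (φ j))) (fun j => hmO (hslab (hAB _)))
      (hmO (hslab hABU)) (hmO (hslab hABW)) h1 h2
  -- the identity theorem: the two limits agree on the whole open past
  have heq : ∀ t < 0, ∀ x, U' t x = W' t x := by
    refine eq_past_of_ae_eq_on hABU.1 hABW.1 (K := O) ?_ (hae.mono fun z hz => by simpa [uncurry] using hz)
    rw [hO.interior_eq]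
    obtain ⟨z, hz⟩ := hne
    exact ⟨z, hz, parabolicCylinder_subset_lowerHalf R₀ (0 : (EuclideanSpace ℝ (Fin 3))) (hOs hz)⟩
  -- hence `‖U_φj − W_φj‖_{L³(Q₁)} → 0`, contradicting `ε ≤ ‖U_φj − W_φj‖_{L³(Q₁)}`
  set Q : Set (ℝ × (EuclideanSpace ℝ (Fin 3))) := parabolicCylinder 1 (0 : ℝ × (EuclideanSpace ℝ (Fin 3))) with hQ
  have hmQ : ∀ {V : ℝ → (EuclideanSpace ℝ (Fin 3)) → (EuclideanSpace ℝ (Fin 3))},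
      ContinuousOn (uncurry V) (Iio (0 : ℝ) ×ˢ (univ : Set (EuclideanSpace ℝ (Fin 3)))) →
      AEStronglyMeasurable (uncurry V) (volume.restrict Q) :=
    fun hV => aestronglyMeasurable_parabolicCylinder_of_continuousOn hV 1
  have hQeq : uncurry U' =ᵐ[volume.restrict Q] uncurry W' := by
    filter_upwards [ae_restrict_mem (isOpen_parabolicCylinder _ _).measurableSet] with z hz
    have hz1 : z.1 < 0 := (mem_prod.1 (parabolicCylinder_subset_lowerHalf 1 (0 : (EuclideanSpace ℝ (Fin 3))) hz)).1
    simpa [uncurry] using heq z.1 hz1 z.2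
  have hQ0 : Tendsto (fun j => eLpNorm (uncurry (Us (φ j)) - uncurry (Ws (φ j))) 3 (volume.restrict Q))
      atTop (𝓝 0) := by
    have hsum := (hconvU' 1 one_pos).add (hconvW' 1 one_pos)
    rw [add_zero] at hsum
    refine tendsto_of_tendsto_of_tendsto_of_le_of_le tendsto_const_nhds hsum (fun _ => bot_le) fun j => ?_
    have e : uncurry (Us (φ j)) - uncurry (Ws (φ j)) =
        (uncurry (Us (φ j)) - uncurry U') + (uncurry U' - uncurry (Ws (φ j))) := by abel
    have e2 : eLpNorm (uncurry U' - uncurry (Ws (φ j))) 3 (volume.restrict Q) =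
        eLpNorm (uncurry (Ws (φ j)) - uncurry W') 3 (volume.restrict Q) := by
      rw [eLpNorm_congr_ae (hQeq.sub (EventuallyEq.refl _ (uncurry (Ws (φ j))))), eLpNorm_sub_comm]
    rw [e]
    calc eLpNorm ((uncurry (Us (φ j)) - uncurry U') + (uncurry U' - uncurry (Ws (φ j)))) 3 (volume.restrict Q)
        ≤ eLpNorm (uncurry (Us (φ j)) - uncurry U') 3 (volume.restrict Q) +
            eLpNorm (uncurry U' - uncurry (Ws (φ j))) 3 (volume.restrict Q) :=
          eLpNorm_add_le ((hmQ (hslab (hAB _))).sub (hmQ (hslab hABU)))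
            ((hmQ (hslab hABU)).sub (hmQ (hslab (hAB' _)))) (by norm_num)
      _ = _ := by rw [e2]
  have hle : ε ≤ 0 := ge_of_tendsto' hQ0 fun j => hbig (φ j)
  exact hε.ne' (le_antisymm hle bot_le)

/-- ★★ **K1′. ORBIT FORM**: smallness of the self-similarity defect `U_c − U` at ANY scale `c > 0` transfers from
any keyhole to the unit cylinder, with `δ = δ(M, I, O, ε)` INDEPENDENT of `c` (the rescaled object is again an
A–B object of the class at the same level: `abTower_zoom`, `typeIBound_lowerHalf_nsZoom`). -/
theorem abTower_orbit_smallness_transfer (M : ℝ) {I : ℝ≥0∞} (hI : I < ⊤)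
    {O : Set (ℝ × (EuclideanSpace ℝ (Fin 3)))} (hO : IsOpen O) (hne : O.Nonempty) {R₀ : ℝ} (hR₀ : 0 < R₀)
    (hOs : O ⊆ parabolicCylinder R₀ (0 : ℝ × (EuclideanSpace ℝ (Fin 3)))) {ε : ℝ≥0∞} (hε : 0 < ε) :
    ∃ δ : ℝ≥0∞, 0 < δ ∧
      ∀ (U : ℝ → (EuclideanSpace ℝ (Fin 3)) → (EuclideanSpace ℝ (Fin 3)))
        (P : ℝ → (EuclideanSpace ℝ (Fin 3)) → ℝ)
        (H : ℝ → (EuclideanSpace ℝ (Fin 3)) → (EuclideanSpace ℝ (Fin 3)) →L[ℝ] (EuclideanSpace ℝ (Fin 3))),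
        ABTower M U P H →
          typeIBound (Iio (0 : ℝ) ×ˢ (univ : Set (EuclideanSpace ℝ (Fin 3)))) U P H ≤ I →
          ∀ c : ℝ, 0 < c →
            eLpNorm (uncurry (nsRescale c U) - uncurry U) 3 (volume.restrict O) ≤ δ →
            eLpNorm (uncurry (nsRescale c U) - uncurry U) 3
              (volume.restrict (parabolicCylinder 1 (0 : ℝ × (EuclideanSpace ℝ (Fin 3))))) < ε := by
  obtain ⟨δ, hδ, h⟩ := abTower_smallness_transfer M hI hO hne hR₀ hOs hε
  refine ⟨δ, hδ, fun U P H hT hIU c hc hsmall => ?_⟩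
  have hz := abTower_zoom hT 0 hc
  rw [← nsRescale_eq_smul_stPull] at hz
  exact h _ _ _ U P H hz hT
    (by rw [nsRescale_eq_smul_stPull, typeIBound_lowerHalf_nsZoom hc U P H]; exact hIU) hIU hsmall

/-- ★★★ **K2. THE NEAR-IDENTITY RUNG IS OPEN AT EACH FIXED FACTOR — THROUGH ANY KEYHOLE.**  With
`c₁ = Λ(M, 4I) > 1` of Z3/H4: for every fixed `c ∈ (1/c₁, 1)` and every open nonempty keyhole `O ⋐ Q_{R₀}(0,0)`
there is `η = η(M, I, c, O) > 0` such that EVERY rooted A–B object of the class at level `≤ I` satisfies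
`‖U_c − U‖_{L³(O)} ≥ η`: a Type-I singularity model is never almost self-similar with a near-one factor, not even
when watched through an arbitrarily small space–time keyhole anywhere in its past (E16 + K1′). -/
theorem abTower_nearOne_defect_floor_keyhole (M : ℝ) {I : ℝ≥0∞} (hI : I < ⊤)
    {O : Set (ℝ × (EuclideanSpace ℝ (Fin 3)))} (hO : IsOpen O) (hne : O.Nonempty) {R₀ : ℝ} (hR₀ : 0 < R₀)
    (hOs : O ⊆ parabolicCylinder R₀ (0 : ℝ × (EuclideanSpace ℝ (Fin 3)))) :
    ∃ c₁ : ℝ, 1 < c₁ ∧ ∀ c : ℝ, c₁⁻¹ < c → c < 1 →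
      ∃ η : ℝ≥0∞, 0 < η ∧
        ∀ (U : ℝ → (EuclideanSpace ℝ (Fin 3)) → (EuclideanSpace ℝ (Fin 3)))
          (P : ℝ → (EuclideanSpace ℝ (Fin 3)) → ℝ)
          (H : ℝ → (EuclideanSpace ℝ (Fin 3)) → (EuclideanSpace ℝ (Fin 3)) →L[ℝ] (EuclideanSpace ℝ (Fin 3))),
          ABTower M U P H → ¬ RegPt U 0 →
            typeIBound (Iio (0 : ℝ) ×ˢ (univ : Set (EuclideanSpace ℝ (Fin 3)))) U P H ≤ I →
            η ≤ eLpNorm (uncurry (nsRescale c U) - uncurry U) 3 (volume.restrict O) := by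
  obtain ⟨c₁, hc₁, hE⟩ := abTower_nearOne_defect_floor' M hI
  refine ⟨c₁, hc₁, fun c hcl hcu => ?_⟩
  have hc0 : 0 < c := (inv_pos.2 (zero_lt_one.trans hc₁)).trans hcl
  obtain ⟨η, hη, hfl⟩ := hE c hcl hcu
  obtain ⟨δ, hδ, htr⟩ := abTower_orbit_smallness_transfer M hI hO hne hR₀ hOs hη
  refine ⟨δ, hδ, fun U P H hT hs hl => ?_⟩
  by_contra hlt
  push Not at hlt
  exact absurd (hfl U P H hT hs hl) (not_le.2 (htr U P H hT hl c hc0 hlt.le))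

/-- **K2′. Census reading (TNode form) of K2.** -/
theorem RootObj.nearOne_defect_floor_keyhole (M : ℝ) {I : ℝ≥0∞} (hI : I < ⊤)
    {O : Set (ℝ × (EuclideanSpace ℝ (Fin 3)))} (hO : IsOpen O) (hne : O.Nonempty) {R₀ : ℝ} (hR₀ : 0 < R₀)
    (hOs : O ⊆ parabolicCylinder R₀ (0 : ℝ × (EuclideanSpace ℝ (Fin 3)))) :
    ∃ c₁ : ℝ, 1 < c₁ ∧ ∀ c : ℝ, c₁⁻¹ < c → c < 1 →
      ∃ η : ℝ≥0∞, 0 < η ∧ ∀ n : TNode, RootObj M n →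
        typeIBound (Iio (0 : ℝ) ×ˢ (univ : Set (EuclideanSpace ℝ (Fin 3)))) n.U n.P n.H ≤ I →
          η ≤ eLpNorm (uncurry (nsRescale c n.U) - uncurry n.U) 3 (volume.restrict O) := by
  obtain ⟨c₁, hc₁, h⟩ := abTower_nearOne_defect_floor_keyhole M hI hO hne hR₀ hOs
  refine ⟨c₁, hc₁, fun c hcl hcu => ?_⟩
  obtain ⟨η, hη, h'⟩ := h c hcl hcu
  exact ⟨η, hη, fun n hn hIn => h' n.U n.P n.H hn.1 hn.2 hIn⟩

end Keyhole

end Summit.NavierStokesRegularity.NavierStokesRegularity.Cruxes.ScarEnvelopeTypeI.ZoomDictionary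

end
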